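import Summits.CriticalPhenomena.CardyFormulaZ2.Theses.CardyMirrorMonotone
import Summits.CriticalPhenomena.CardyFormulaZ2.Theorems.CardyAnchoredRigiditySubseqCardyKernelDuality
import Summits.CriticalPhenomena.CardyFormulaZ2.Theorems.CardyAnchoredRigiditySubseqCardyKernelFacts
import Literature.Probability.RandomPlanarGeometry.CardyFunctionIncBeta

/-!
# Witness of weakness (BC5 / T1(d) separating witness) for the crux `SubseqRigidity`
# (stmt-CriticalPhenomena-8271, route CardyMirrorMonotone) — strategist r1, 2026-08-17

The crux, verbatim: `SubseqRigidity := ∀ u, u → 0⁺ → ∀ g, HYPSEQ u g → EqOn g F (Ioo 0 1)` with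
`HYPSEQ u g := ∀ R φ x, R.IsUniformizing φ x → Tendsto (n ↦ bondDomainCrossingProb R (u n)) atTop (𝓝 (g (crossRatio x)))`
(a SEQUENTIAL CROSSING KERNEL of bond-ℤ² percolation at p = 1/2) and `F = cardyFunction`.

This file records, sorry-free, over landed tree theorems only:

* `at_iff` — the crux is the conjunction over `η ∈ (0,1)` of its single-modulus instances
  `SubseqRigidityAt η := ∀ u g, u → 0⁺ → HYPSEQ u g → g η = F η`;
* `rung_half : SubseqRigidityAt (1/2)` — **a DECIDED INSTANCE of the crux**: every sequential crossing
  kernel takes Cardy's value `F (1/2) = 1/2` at modulus `1/2` (self-duality of joint sequential limits,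
  `Kernel.apply_half`, + `cardyFunction_one_sub_holds`).  The matching instance of the sub-problem
  statement S = `CardyFormulaZ2` — "the crossing probability of EVERY conformal rectangle of modulus 1/2
  tends to 1/2" — is OPEN (it is a slice of conformal invariance on ℤ²; only dihedrally symmetric shapes
  such as the square are known), so this rung lies outside S's proved regime;
* `rung_shape` — every sequential crossing kernel already shares with `F` Cardy's functional equation
  `g η + g (1-η) = 1`, strict monotonicity and continuity on `(0,1)`, the boundary values `g(0⁺) = 0`,
  `g(1⁻) = 1` and `(0,1)`-valuedness (`seqKernel_selfDual`, `seqKernel_strictMonoOn`, `seqKernelFacts`) —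
  the kernel inputs of the martingale identification line (`Cruxes/CardyRigidity/Lines/crossing_martingale`).
-/

noncomputable section

namespace Summit.CriticalPhenomena.CardyFormulaZ2.Cruxes.SubseqRigidity.Strategist

open Set Filter Topology
open Literature.Probability.RandomPlanarGeometry
open Literature.Probability.Percolation (bondDomainCrossingProb)
open Summit.CriticalPhenomena.CardyFormulaZ2.Theses
open Summit.CriticalPhenomena.CardyFormulaZ2.Cruxes.SubseqCardy.Birth

/-- The hypothesis of the crux: `(u, g)` is a sequential crossing kernel of bond-ℤ² percolation. -/
def HypSeq (u : ℕ → ℝ) (g : ℝ → ℝ) : Prop :=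
  ∀ (R : ConformalRectangle) (φ : ConformalEquiv UpperHalfPlane.upperHalfPlaneSet R.carrier)
    (x : Fin 4 → ℝ), R.IsUniformizing φ x →
      Tendsto (fun n => bondDomainCrossingProb R (u n)) atTop (𝓝 (g (crossRatio x)))

/-- The single-modulus instance of the crux at `η`. -/
def SubseqRigidityAt (η : ℝ) : Prop :=
  ∀ u : ℕ → ℝ, Tendsto u atTop (𝓝[>] (0 : ℝ)) → ∀ g : ℝ → ℝ, HypSeq u g → g η = cardyFunction η

/-- The crux is exactly the conjunction of its single-modulus instances over `(0,1)`. [folklore] -/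
theorem at_iff : CardyMirrorMonotone.SubseqRigidity ↔ ∀ η ∈ Ioo (0 : ℝ) 1, SubseqRigidityAt η :=
  ⟨fun h η hη u hu g hg ↦ h u hu g hg hη, fun h u hu g hg η hη ↦ h η hη u hu g hg⟩

/-- **RUNG (decided instance of the crux): `SubseqRigidityAt (1/2)`** — every sequential crossing
kernel of bond-ℤ² percolation equals Cardy's function at modulus `1/2`. [folklore] -/
theorem rung_half : SubseqRigidityAt (1 / 2) := by
  intro u hu g hg
  have hg' : g (1 / 2) = 1 / 2 := Kernel.apply_half hu hg
  have hF : cardyFunction (1 - 1 / 2) = 1 - cardyFunction (1 / 2) :=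
    cardyFunction_one_sub_holds (η := 1 / 2) ⟨by norm_num, by norm_num⟩
  rw [show (1 : ℝ) - 1 / 2 = 1 / 2 by norm_num] at hF
  have hF' : cardyFunction (1 / 2) = 1 / 2 := by linarith
  rw [hg', hF']

/-- **RUNG (shape): every sequential crossing kernel already has Cardy's functional equation, strict
monotonicity, continuity, boundary values and non-degeneracy.** [folklore] -/
theorem rung_shape : ∀ u : ℕ → ℝ, Tendsto u atTop (𝓝[>] (0 : ℝ)) → ∀ g : ℝ → ℝ, HypSeq u g →
    (∀ η ∈ Ioo (0 : ℝ) 1, g η + g (1 - η) = 1) ∧ StrictMonoOn g (Ioo (0 : ℝ) 1) ∧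
      ContinuousOn g (Ioo (0 : ℝ) 1) ∧ Tendsto g (𝓝[>] (0 : ℝ)) (𝓝 0) ∧
        Tendsto g (𝓝[<] (1 : ℝ)) (𝓝 1) ∧ ∀ η ∈ Ioo (0 : ℝ) 1, g η ∈ Ioo (0 : ℝ) 1 := by
  intro u hu g hg
  obtain ⟨hdual, -, hIoo⟩ := seqKernel_selfDual u hu g hg
  obtain ⟨hcont, h0, h1⟩ := seqKernelFacts u hu g hg
  exact ⟨hdual, seqKernel_strictMonoOn u hu g hg, hcont, h0, h1, hIoo⟩

end Summit.CriticalPhenomena.CardyFormulaZ2.Cruxes.SubseqRigidity.Strategist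

end
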